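import Summits.SmoothPoincare4.SmoothPoincare4.Theses.EntropyRung
import Literature.Geometry.Riemannian.RicciFlowMaximal

/-!
# Line `decay-or-expand` for crux `EntropyRung.NoncompactShrinkerGap` (stmt-SmoothPoincare4-10868)

Skeleton (crux-plan seat `planner-cruxplan-stmt-SmoothPoincare4-10868-decay-or-expand-0`, 2026-08-16) of
idea card `Ideas/decay-or-expand.md` (ideator 1, round 1), with the sharpenings of TRIAGE-r1-1/2 (pass)
and the answer to TRIAGE-r1-3 (fail: "the typed skeleton `crux_of_decay` is logically empty beyond (E) —
all mathematics sits in the untyped predicate `Stable`").  THE ANSWER: `Stable` is now TYPED, over the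
route's own fact-free vocabulary plus the tree's Ricci-flow definitions (`IsRicciFlow`,
`CurvatureBoundedBy`, RicciFlow.lean / RicciFlowMaximal.lean — real definitions, no named fact enters a
signature), as the conjunction of two concrete clauses on compactly supported perturbations `g'` of the
shrinker metric `g` on the SAME manifold `M`:
* VARIATIONAL ν-STABILITY: no `g'` with `g' = g` off a compact set has an entropy floor
  `μ(g',τ) ≥ c ∀ τ` with `16π² e^c > Z(g,f)` (i.e. `ν(g') > log Θ(g)`) — hypothesis of `stub_stableGap`;
* UPWARD IMMORTALITY: every such ν-raising `g'` is the initial value of an immortal Ricci flow of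
  Riemannian metrics with curvature bounded on compact time intervals — hypothesis of `stub_immortalGap`;
and the card's mechanism (D) becomes a STAND-ALONE LEMMA with no maximiser in it
(`stub_decayOrExpand`: NON-COMPACT ENTROPY DOMINANCE — a complete non-compact bounded-curvature 4-manifold
perturbed to `ν > c > ν_cyl` either flows immortally or produces a complete NON-COMPACT non-flat smooth
shrinker of density `≥ e^c`; the non-compact twin of `stub_entropyDominance` of the sibling line
`CompactShrinkerGap/Lines/decay-climb-numax.lean`, where compactness + `R > 0` force the singular branch).
Line card: `Lines/decay-or-expand.md`.

NOTATION (comments only; every clause is INLINED in the signatures so that a prover's Theorems file never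
imports this work file).  For `(M, g, f, hg)` with the crux binder:
`Shr(M,g,f)` = the five crux clauses (closed `g.edist`-balls compact · `f` smooth · `Ric + Hess f = g/2` ·
`R + |∇f|² = f` · `∃ x, R x ≠ 0`);  `Z(g,f) := ∫⁻ e^{-f} dV_g` (so `Θ = Z/16π²`);
`Z₀ := 32π²√π e^{-3/2} = 16π²·Θ(S³×ℝ) ≈ 124.9`;  `ν_cyl := log 2 + ½ log π − 3/2 = log Θ(S³×ℝ) ≈ −0.2345`;
`BddCurv(g) := ∃ C, CurvatureBoundedBy g g.leviCivita C` (frame form of `sup|Rm| < ∞`);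
`ScalarFlat(g) := ∀ ε > 0 ∃ K compact, R < ε off K` (`R → 0` at infinity; with BddCurv this is
"asymptotically conical", Munteanu–Wang 2017 / Kotschwar–Wang 2015);
`Pert(g,g') := ∃ K compact, g' = g off K` (a compactly supported perturbation, `g'` Riemannian, smooth,
with its own Levi-Civita instance);
`NuFloor(g',c) := ∀ τ > 0 ∀ φ smooth with ∫(4πτ)⁻²e^{-φ}dV' = 1, c ≤ ∫[τ(R' + |∇φ|²) + φ − 4](4πτ)⁻²e^{-φ}dV'`
— VERBATIM the entropy clause of `SubcylindricalRecognition` (`μ(g',τ) ≥ c ∀ τ`, i.e. `ν(g') ≥ c`; on a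
non-compact `M` a non-integrable `φ` makes the Bochner integral `0 ≥ c`, harmless since `c ≤ 0` for
every true floor);  "ν-RAISING": `NuFloor(g',c) ∧ Z(g,f) < 16π² e^c` (`⇔ c > log Θ(g)` by Carrillo–Ni
`log Θ = μ(g,1) = ν(g)`, tree fact `CarrilloNi2009_shrinkerLSI`);
`Immortal(g') := ∃ (G, cov), IsRicciFlow G cov [0,∞) ∧ G 0 = g' ∧ G t Riemannian ∧ ∀ T ∃ C ∀ t ≤ T, |Rm_{G t}| ≤ C`.

THE LINE (5 registered stubs + the kernel-checked composition `NoncompactShrinkerGap_of`):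
* `stub_maximiser` (E, EXTREMISE): the Gaussian density ATTAINS ITS SUPREMUM on the crux class — some
  `Shr(M⋆,g⋆,f⋆)` has `Z(g',f') ≤ Z(g⋆,f⋆)` for every `Shr(M',g',f')`.  Unconditional (the class contains
  the cylinder, `Disproof.tight_at_cylinder`, so `Θ⋆ ≥ .791 > ½` and orbifold limits are excluded).
* `stub_denseIsConical` (SHARED with line `cylindrical-blowdown`, its steps 1+2 in contrapositive, plus
  Munteanu–Wang 2015 `|Rm| ≤ cR`): `Shr ∧ Z > Z₀ ⇒ BddCurv ∧ ScalarFlat`.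
* `stub_decayOrExpand` (D, the card's lever as a lemma): `(M,g)` complete connected non-compact with
  `BddCurv`, `Pert(g,g')`, `ν_cyl < c`, `NuFloor(g',c)` ⇒ `Immortal(g') ∨ ∃ Shr(M',g'',f'')` with
  `Z(g'',f'') ≥ 16π² e^c`.
* `stub_stableGap` (C⁺₁, HARDEST): `Shr ∧ BddCurv ∧ ScalarFlat ∧ (no ν-raising Pert) ⇒ Z ≤ Z₀`.
* `stub_immortalGap` (C⁺₂): `Shr ∧ BddCurv ∧ ScalarFlat ∧ (∃ ν-raising Pert) ∧ (every ν-raising Pert is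
  Immortal) ⇒ Z ≤ Z₀`.
* `NoncompactShrinkerGap_of : NoncompactShrinkerGap` — given `Shr(M,g,f)` with (absurdly) `Z > Z₀`: the
  maximiser of stub 1 is dense; stub 2 makes it bounded-curvature and AC; for each ν-raising perturbation,
  stub 3 gives an immortal flow OR a denser non-compact shrinker, and the latter contradicts maximality
  (this is where EXTREMALITY is spent); so the maximiser is upward-immortal, and stub 5 (if some
  perturbation raises ν) or stub 4 (if none does) bounds it by `Z₀` — contradiction.  Real proof, no sorry
  of its own; `nucyl_lt_of_lt` is the threshold arithmetic `Z₀ < 16π²e^c ⇒ ν_cyl < c`.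

LOGICAL CONTENT (the triage-3 test re-run on this skeleton): no stub is implied by another; stubs 1 and 3
do not mention `Z₀` at all and are believed TRUE UNCONDITIONALLY (compactness, resp. Perelman–Bamler);
stub 2 is the crux on the non-AC class (settled on paper for bounded curvature, Disproof §3(i)); stubs 4
and 5 are the crux on the AC class split by a typed, exhaustive dichotomy (variationally stable /
admits a ν-raising perturbation), each WEAKER than `ScalarFlatGap` of SketchK1 and each carrying an extra
structural hypothesis with its own toolkit (second variation `N̂` of ν, Cao–Zhu 2012; immortal flows out
of a cone and expanders, Bernstein–Wang 2017 / Deruelle–Schulze–Simon / Bamler–Chen).  Instantiating the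
old abstract `Stable` by `Z ≤ Z₀` is no longer possible: the predicates are fixed.

DISPROOF.LEAN (v6, 2026-08-16T01:13Z) HONOURED: `_false_without_noncompact` — `[NoncompactSpace M]` is
load-bearing in stub 3 (on a closed `M` with `R > 0` the flow is singular and the model compact: the
second disjunct needs the models-are-non-compact lemma) and in stub 1 (else `S⁴`, `Z = 96π²e⁻² > Z₀`,
would be the maximiser); `_false_without_nonflat` — `∃ x, R x ≠ 0` kept in every `Shr` (else the
Gaussian, `Z = 16π²`, ν-stable and flat-AC, would falsify stub 4 and top stub 1); `_false_without_complete`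
— completeness kept everywhere (Shi's flow in stub 3, HM/LLW compactness in stub 1);
`_false_without_normalisation` — `R + |∇f|² = f` kept in every `Shr`, including the shrinker PRODUCED by
stub 3; `tight_at_cylinder` / `not_strict` — stubs 4/5 conclude `≤`, stub 1 allows `Z⋆ = Z₀` (the
composition only refutes `Z₀ < Z`); `lintegral_lt_top_of_gap` — finiteness `Z < ⊤` is inside stub 1's
proof (Cao–Zhou 2010) and is recorded there; `t3Space_of_chartedSpace` — `[T3Space M]` kept only to match
the crux binder literally.  Landed Negative lemmas under `Theorems/NoncompactShrinkerGap/Negative/`: none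
exist (2026-08-16); `ledger negatives --problem SmoothPoincare4`: 0.
-/

noncomputable section

namespace Summit.SmoothPoincare4.SmoothPoincare4.Cruxes.NoncompactShrinkerGap.DecayOrExpand

open scoped Manifold ContDiff ENNReal Topology
open MeasureTheory Set
open Summit.SmoothPoincare4.SmoothPoincare4.Theses.EntropyRung
open Literature.Geometry.Lorentzian Literature.Geometry.Riemannian

set_option linter.unusedVariables false
set_option linter.dupNamespace false

/-- **stub 1 — `stub_maximiser` (E: EXTREMISE).** The Gaussian density attains its supremum on the
crux class: there is a complete connected non-compact non-flat normalised smooth 4-d gradient shrinker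
`(M⋆, g⋆, f⋆)` (`Shr`, same binder as the crux) with `Z(g',f') ≤ Z(g⋆,f⋆)` for EVERY member `(M',g',f')`
of the class (all `M' : Type`, as in the crux).
Intended proof (TRIAGE-r1-1/2: "essentially in print"): the class is non-empty (round cylinder,
`Disproof.tight_at_cylinder`), so `Θ⋆ := sup Θ ∈ [Θ(S³×ℝ), 1]`; every member has `Z < ⊤` and `Θ ≤ 1 − δ₀`
(Cao–Zhou 2010 volume growth + Carrillo–Ni `μ(g,1) = log Θ ≤ 0`; Yokota 2009 / Li–Wang arXiv:1901.05691
Thm 1.3 gap for non-flat shrinkers); a maximising sequence has `μ ≥ log Θ_cyl − 1`, hence subconverges in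
the pointed orbifold Cheeger–Gromov sense (Haslhofer–Müller arXiv:1407.1683 Thm 1.1, 4-d, entropy bound
only, non-compact allowed; or Li–Li–Wang arXiv:1809.04049 Thm 1.1) and the weighted volume PASSES TO THE
LIMIT (LLW Thm 1.2(c): `∫_{M∞} e^{-f∞} = lim ∫_{M_i} e^{-f_i}`), so the limit has `Θ = Θ⋆`; it is
non-compact (pointed limit of connected spaces of infinite diameter), non-flat (`Θ⋆ ≤ 1 − δ₀ < 1`),
normalised (pointwise limit of `R + |∇f|² = f`) and SMOOTH: an orbifold point of order `|Γ| ≥ 2` forces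
`Θ ≤ 1/|Γ| ≤ ½ < .791 ≤ Θ⋆` (`ν ≤ lim_{τ→0} μ(g,τ) = μ(ℝ⁴/Γ) = −log|Γ|`; the ideator's toric-orbifold table
`ℙ(1,1,k)`, k = 2..8, all below `1/k`, asymptotically sharp).
Why it might fail: only through the three unvendored facts (HM15 Thm 1.1, LLW Thm 1.2(c), the
orbifold-density lemma) — each printed or folklore with a one-line proof; formally the limit must be
re-packaged as a `ChartedSpace (EuclideanSpace ℝ (Fin 4))` manifold with a `PseudoRiemannianMetric` and a
`HasLeviCivita` instance (`HasLeviCivita.of` + the named fact `isCovariantDerivativeOn_leviCivitaFun`).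
Size: L.  Sources: arXiv:1407.1683 Thm 1.1; arXiv:1809.04049 Thm 1.1, 1.2(c); arXiv:1901.05691 Thm 1.1,
1.3; CaoZhou2010; CarrilloNi2009; Yokota2009; card §Lever (E); TRIAGE-r1-2 sharpen (2)–(3). -/
theorem stub_maximiser :
    ∃ (M : Type) (_ : TopologicalSpace M) (_ : T2Space M) (_ : SecondCountableTopology M)
      (_ : ChartedSpace (EuclideanSpace ℝ (Fin 4)) M) (_ : IsManifold (𝓡 4) ∞ M) (_ : ConnectedSpace M)
      (_ : NoncompactSpace M) (_ : T3Space M) (_ : MeasurableSpace M) (_ : BorelSpace M)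
      (g : PseudoRiemannianMetric (𝓡 4) ∞ (EuclideanSpace ℝ (Fin 4)) (TangentSpace (𝓡 4) : M → Type _))
      (_ : g.HasLeviCivita) (f : M → ℝ) (hg : g.IsRiemannian),
      (∀ (x : M) (r : NNReal), IsCompact {y : M | g.edist hg x y ≤ r}) ∧
      ContMDiff (𝓡 4) 𝓘(ℝ, ℝ) ∞ f ∧
      (∀ (x : M) (X Y : TangentSpace (𝓡 4) x),
        g.ricci x X Y + g.hessian f x X Y = (1 / 2 : ℝ) * g.val x X Y) ∧
      (∀ x : M, g.scalarCurvature x + g.gradSq f x = f x) ∧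
      (∃ x : M, g.scalarCurvature x ≠ 0) ∧
      ∀ (M' : Type) [TopologicalSpace M'] [T2Space M'] [SecondCountableTopology M']
      [ChartedSpace (EuclideanSpace ℝ (Fin 4)) M'] [IsManifold (𝓡 4) ∞ M'] [ConnectedSpace M']
      [NoncompactSpace M'] [T3Space M'] [MeasurableSpace M'] [BorelSpace M']
      (g' : PseudoRiemannianMetric (𝓡 4) ∞ (EuclideanSpace ℝ (Fin 4)) (TangentSpace (𝓡 4) : M' → Type _))
      [g'.HasLeviCivita] (f' : M' → ℝ) (hg' : g'.IsRiemannian),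
      (∀ (x : M') (r : NNReal), IsCompact {y : M' | g'.edist hg' x y ≤ r}) →
      ContMDiff (𝓡 4) 𝓘(ℝ, ℝ) ∞ f' →
      (∀ (x : M') (X Y : TangentSpace (𝓡 4) x),
        g'.ricci x X Y + g'.hessian f' x X Y = (1 / 2 : ℝ) * g'.val x X Y) →
      (∀ x : M', g'.scalarCurvature x + g'.gradSq f' x = f' x) →
      (∃ x : M', g'.scalarCurvature x ≠ 0) →
      ∫⁻ x, ENNReal.ofReal (Real.exp (-f' x)) ∂(riemannianMeasure (g'.toContMDiffRiemannianMetric hg')) ≤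
        ∫⁻ x, ENNReal.ofReal (Real.exp (-f x)) ∂(riemannianMeasure (g.toContMDiffRiemannianMetric hg)) := by
  sorry

/-- **stub 2 — `stub_denseIsConical` (SHARED with line `cylindrical-blowdown`; prerequisite of the
dynamics).** A member of the crux class with `Z > Z₀` (density above the cylinder) has BOUNDED CURVATURE
(`∃ C, CurvatureBoundedBy g g.leviCivita C`) and is SCALAR-FLAT AT INFINITY (`R → 0`), hence
asymptotically conical (Munteanu–Wang arXiv:1410.3813 + Kotschwar–Wang 2015).
Intended proof = steps (1)+(2) of card `cylindrical-blowdown` in contrapositive (SketchK1: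
`UnboundedScalarGap ∧ NonDecayingScalarGap`), plus Munteanu–Wang 2015 (`R` bounded ⇒ `|Rm| ≤ cR` on a 4-d
shrinker) to pass from `ScalarBounded` to the frame bound: (1) unbounded `R` ⇒ point-pick `x_k → ∞`,
𝔽-limit of the induced flows based at receding points (Li–Wang II arXiv:2301.08430 §6, Thm 6.10/6.12;
Bertellotti–Buzano arXiv:2508.10790 Thm 1.4) is steady-or-split with Nash entropy `≥ log Θ(M)`, its tangent
flow at `−∞` is in the Bamler–Chow–Deng–Ma–Zhang list (arXiv:2102.04649 Prop 4: `ℝ⁴/Γ`, `S³/Γ×ℝ`, `S²×ℝ²`,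
`((S²×ℝ)/ℤ₂)×ℝ`, all `≤ .791`) ⇒ `Θ(M) ≤ .791`; (2) bounded curvature and `R ↛ 0` along a divergent
sequence ⇒ a smooth split limit `N³×ℝ`, `N ∈ {S³/Γ, S²×ℝ, (S²×ℝ)/ℤ₂}` and `μ(·,1)` is upper-semicontinuous
⇒ `Θ(M) ≤ Θ(N) ≤ Θ(S³)` (Disproof docblock §3(i); B–B Thm 1.8).  So `Z > Z₀` forces bounded `R` and `R → 0`.
Why it might fail: step (1) needs BCDMZ Prop 4 / Bamler 2020c Thm 2.40/2.46 for 𝔽-limits at SPATIAL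
INFINITY of shrinker-induced non-compact flows without curvature bound — printed only for singularity
models of compact flows (all three triagers: "THE technical lemma of the surviving lines"); no complete
shrinker with `sup|Rm| = ∞` is known in any dimension, so no counterexample is available either.
Size: XL (step 1) + L (step 2).  Sources: arXiv:2102.04649 Prop 4; arXiv:2301.08430 Thm 6.10–6.12;
arXiv:2508.10790 Thm 1.4, 1.7–1.8; arXiv:1606.01861; MunteanuWang2015; card cylindrical-blowdown;
TRIAGE-r1-1 sharpen, r1-3 sharpen 1–2.  If line `cylindrical-blowdown` lands its steps 1–2, this stub is
their conjunction + MW15 (prove once, `--supports` both cruxes' registrations). -/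
theorem stub_denseIsConical :
    ∀ (M : Type) [TopologicalSpace M] [T2Space M] [SecondCountableTopology M]
      [ChartedSpace (EuclideanSpace ℝ (Fin 4)) M] [IsManifold (𝓡 4) ∞ M] [ConnectedSpace M]
      [NoncompactSpace M] [T3Space M] [MeasurableSpace M] [BorelSpace M]
      (g : PseudoRiemannianMetric (𝓡 4) ∞ (EuclideanSpace ℝ (Fin 4)) (TangentSpace (𝓡 4) : M → Type _))
      [g.HasLeviCivita] (f : M → ℝ) (hg : g.IsRiemannian),
      (∀ (x : M) (r : NNReal), IsCompact {y : M | g.edist hg x y ≤ r}) →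
      ContMDiff (𝓡 4) 𝓘(ℝ, ℝ) ∞ f →
      (∀ (x : M) (X Y : TangentSpace (𝓡 4) x),
        g.ricci x X Y + g.hessian f x X Y = (1 / 2 : ℝ) * g.val x X Y) →
      (∀ x : M, g.scalarCurvature x + g.gradSq f x = f x) →
      (∃ x : M, g.scalarCurvature x ≠ 0) →
      ENNReal.ofReal (32 * Real.pi ^ 2 * Real.sqrt Real.pi * Real.exp (-(3 : ℝ) / 2)) <
        ∫⁻ x, ENNReal.ofReal (Real.exp (-f x)) ∂(riemannianMeasure (g.toContMDiffRiemannianMetric hg)) →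
      (∃ C : ℝ, CurvatureBoundedBy g g.leviCivita C) ∧
      (∀ ε : ℝ, 0 < ε → ∃ K : Set M, IsCompact K ∧ ∀ x : M, x ∉ K → g.scalarCurvature x < ε) := by
  sorry

/-- **stub 3 — `stub_decayOrExpand` (D: the card's lever, as a stand-alone lemma — NON-COMPACT
ENTROPY DOMINANCE / "decay or expand").** Let `(M, g)` be a complete connected NON-COMPACT Riemannian
4-manifold with bounded curvature, `g'` a smooth Riemannian metric equal to `g` off a compact set, and
`c > ν_cyl` an entropy floor of `g'` (`NuFloor(g',c)`: `μ(g',τ) ≥ c` for all `τ > 0`).  Then EITHER `g'`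
is the initial metric of an IMMORTAL Ricci flow of Riemannian metrics with curvature bounded on compact
time intervals (`Immortal(g')`), OR there is a complete connected non-compact non-flat normalised smooth
4-d gradient shrinker `(M', g'', f'')` (a member of the crux class) with `Z(g'',f'') ≥ 16π² e^c`, i.e.
`Θ ≥ e^c`.  No shrinker structure on `g` and no maximiser enter: the composition spends maximality.
Intended proof (Perelman–Bamler bookkeeping, card (D), TRIAGE-r1-1 notes (a)(c)): `g'` is complete with
bounded curvature (it differs from `g` on a compact set), so Shi's flow exists on a maximal `[0,T)` with
curvature bounded on compact sub-intervals (Shi 1989; Chen–Zhu 2006 uniqueness); if `T = ∞` we are in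
the first branch.  If `T < ∞`, `sup_M |Rm|(·,t) → ∞`; Perelman's monotonicity holds for complete
bounded-curvature flows (Chau–Tam–Yu 2011), so every conjugate heat kernel has Nash entropy
`𝒩_{x,t}(τ) ≥ μ(g', τ + t) ≥ c`, whence no-local-collapsing; point-pick `(x_k,t_k)` (possibly ESCAPING TO
SPATIAL INFINITY — there is no based tangent flow there, one works with 𝔽-limits based at `(x_k,t_k)`,
Bamler arXiv:2008.09298 / 2009.03243 in the complete bounded-curvature-on-compact-intervals class, cf.
Chan–Ma–Zhang arXiv:2401.03387); the limit metric flow is non-flat (ε-regularity at the picked points),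
its tangent flow at `−∞` is a 4-d metric soliton = gradient shrinker smooth off isolated orbifold points
with `Θ = e^{𝒩(∞)} ≥ e^c > e^{ν_cyl} = .791 > ½`, hence WITHOUT orbifold points (order `|Γ|` costs
`Θ ≤ 1/|Γ|`), complete, non-flat (`Θ ≤ e^{𝒩(1)} < 1`), normalisable; and it is NON-COMPACT: a compact
smooth tangent flow forces smooth convergence (Bamler), so a compact regular slice would be diffeomorphic,
for large `k`, to an open-closed subset of the connected non-compact `M` — impossible.  That shrinker is
the second branch.
Why it might fail: Bamler's 𝔽-compactness / structure theory and the "compact smooth tangent flow ⇒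
smooth convergence" step are PRINTED FOR COMPACT `M`; the complete non-compact bounded-curvature
extension (heat-kernel bounds of Chau–Tam–Yu / Bamler–Chan–Ma–Zhang) is asserted in the literature but
not written in this generality, and blow-up sequences escaping to spatial infinity at the singular time
must be handled inside it (TRIAGE-r1-1 (c)).  Junk-semantics check: `NuFloor(g',c)` with `c > ν_cyl` is
satisfiable (small bumps on `ℝ⁴` have `ν` near `0`) and implies `c ≤ 0`; for `c ≤ ν_cyl` the lemma
would be trivial (the cylinder witnesses branch 2), which is why the threshold is in the hypothesis.
Size: XL.  Sources: Perelman2002 §3–4; Shi1989; ChenZhu2006; ChauTamYu2011; arXiv:2008.09298;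
arXiv:2009.03243 §2; arXiv:2401.03387; arXiv:1901.05691 (orbifold density via `μ(ℝ⁴/Γ) = −log|Γ|`);
CaoHamiltonIlmanen2004 §4 ("decay"); card §Lever (D), §Transfer; sibling `decay-climb-numax`
`stub_entropyDominance` (the compact twin). -/
theorem stub_decayOrExpand :
    ∀ (M : Type) [TopologicalSpace M] [T2Space M] [SecondCountableTopology M]
      [ChartedSpace (EuclideanSpace ℝ (Fin 4)) M] [IsManifold (𝓡 4) ∞ M] [ConnectedSpace M]
      [NoncompactSpace M] [T3Space M] [MeasurableSpace M] [BorelSpace M]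
      (g : PseudoRiemannianMetric (𝓡 4) ∞ (EuclideanSpace ℝ (Fin 4)) (TangentSpace (𝓡 4) : M → Type _))
      [g.HasLeviCivita] (hg : g.IsRiemannian),
      (∀ (x : M) (r : NNReal), IsCompact {y : M | g.edist hg x y ≤ r}) →
      (∃ C : ℝ, CurvatureBoundedBy g g.leviCivita C) →
      ∀ (g' : PseudoRiemannianMetric (𝓡 4) ∞ (EuclideanSpace ℝ (Fin 4)) (TangentSpace (𝓡 4) : M → Type _))
      [g'.HasLeviCivita] (hg' : g'.IsRiemannian),
      (∃ K : Set M, IsCompact K ∧ ∀ x : M, x ∉ K → g'.val x = g.val x) →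
      ∀ c : ℝ, Real.log 2 + Real.log Real.pi / 2 - 3 / 2 < c →
      (∀ τ : ℝ, 0 < τ → ∀ φ : M → ℝ, ContMDiff (𝓡 4) 𝓘(ℝ, ℝ) ∞ φ →
          ∫ x, (4 * Real.pi * τ) ^ (-(4 : ℝ) / 2) * Real.exp (-φ x) ∂(riemannianMeasure (g'.toContMDiffRiemannianMetric hg')) = 1 →
          c ≤ ∫ x, (τ * (g'.scalarCurvature x + g'.gradSq φ x) + φ x - 4) *
            ((4 * Real.pi * τ) ^ (-(4 : ℝ) / 2) * Real.exp (-φ x)) ∂(riemannianMeasure (g'.toContMDiffRiemannianMetric hg'))) →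
      (∃ (G : ℝ → PseudoRiemannianMetric (𝓡 4) ∞ (EuclideanSpace ℝ (Fin 4)) (TangentSpace (𝓡 4) : M → Type _))
          (cov : ℝ → CovariantDerivative (𝓡 4) (EuclideanSpace ℝ (Fin 4)) (TangentSpace (𝓡 4) : M → Type _)),
          IsRicciFlow G cov (Set.Ici 0) ∧ G 0 = g' ∧ (∀ t ∈ Set.Ici (0 : ℝ), (G t).IsRiemannian) ∧
          ∀ T : ℝ, ∃ C : ℝ, ∀ t ∈ Set.Icc 0 T, CurvatureBoundedBy (G t) (cov t) C) ∨
      ∃ (M' : Type) (_ : TopologicalSpace M') (_ : T2Space M') (_ : SecondCountableTopology M')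
      (_ : ChartedSpace (EuclideanSpace ℝ (Fin 4)) M') (_ : IsManifold (𝓡 4) ∞ M') (_ : ConnectedSpace M')
      (_ : NoncompactSpace M') (_ : T3Space M') (_ : MeasurableSpace M') (_ : BorelSpace M')
      (g'' : PseudoRiemannianMetric (𝓡 4) ∞ (EuclideanSpace ℝ (Fin 4)) (TangentSpace (𝓡 4) : M' → Type _))
      (_ : g''.HasLeviCivita) (f'' : M' → ℝ) (hg'' : g''.IsRiemannian),
      (∀ (x : M') (r : NNReal), IsCompact {y : M' | g''.edist hg'' x y ≤ r}) ∧
      ContMDiff (𝓡 4) 𝓘(ℝ, ℝ) ∞ f'' ∧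
      (∀ (x : M') (X Y : TangentSpace (𝓡 4) x),
        g''.ricci x X Y + g''.hessian f'' x X Y = (1 / 2 : ℝ) * g''.val x X Y) ∧
      (∀ x : M', g''.scalarCurvature x + g''.gradSq f'' x = f'' x) ∧
      (∃ x : M', g''.scalarCurvature x ≠ 0) ∧
      ENNReal.ofReal (16 * Real.pi ^ 2 * Real.exp c) ≤
        ∫⁻ x, ENNReal.ofReal (Real.exp (-f'' x)) ∂(riemannianMeasure (g''.toContMDiffRiemannianMetric hg'')) := by
  sorry

/-- **stub 4 — `stub_stableGap` (C⁺₁: VARIATIONALLY ν-STABLE AC SHRINKERS ARE SUB-CYLINDRICAL;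
HARDEST).** A member `(M,g,f)` of the crux class with bounded curvature and `R → 0` at infinity
(asymptotically conical) such that NO compactly supported perturbation raises Perelman's ν above
`log Θ(g)` — for every smooth Riemannian `g'` with `g' = g` off a compact set and every `c` with
`NuFloor(g',c)`, `16π² e^c ≤ Z(g,f)` — satisfies `Z(g,f) ≤ Z₀`, i.e. `Θ ≤ Θ(S³×ℝ)`.
This is the typed form of the card's C⁺₁ ("a complete non-compact non-flat ν-linearly-stable 4-d
shrinker has `Θ ≤ Θ(S³×ℝ)`", the DENSITY FORM of the stable/generic-singularity-model conjecture): the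
hypothesis contains linear stability `δ²ν = τ(4πτ)^{-2}∫⟨N̂h,h⟩e^{-f} ≤ 0` on compactly supported `h`
(Cao–Zhu arXiv:1008.0842 Thm 1.1, `N̂ = ½Δ_f + Rm − …` on `ker div_f`) and is stated variationally so
that no 2-tensor calculus is needed to type it; far-out perturbations never raise ν to second order
(`½Δ_f ≤ −¼` by Bakry–Émery vs `Rm → 0` on the cone end), so the clause is about the core.
Why plausibly true: every known AC or stable-candidate non-compact 4-d shrinker complies (`S³/Γ×ℝ`
.791/|Γ| and `S²×ℝ²` .736 are not AC; FIK .672, conjecturally stable, Isenberg–Knopf–Šešum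
arXiv:1703.02918; BCCD .562, Disproof §2; Kähler class ≤ .736, Disproof §2); the MCF dictionary entry is a
THEOREM (Colding–Minicozzi 2012: F-stable self-shrinkers are spheres/cylinders; Bernstein–Wang
arXiv:1504.01996 Cor 1.2 for small entropy in `ℝ³`).
Why it might fail (TRIAGE-r1-3's objection, recorded honestly): on the Ricci side ν-stability yields no
positivity (Cao–Zhu Remark 1.6: `Rc` is a null direction of `N̂`, no Perron–Frobenius), so for the
unknown AC non-Kähler shrinker stability is an extra hypothesis whose only known lever is classification;
a ν-stable AC non-Kähler 4-d shrinker with `Θ ∈ (.791, 1)` refutes the stub AND the crux.  Cheapest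
work: DECIDE numerically the ν-stability of FIK and BCCD (U(2)/toric discretisation of `N̂`, card
§Cheapest falsifier (2)) to fix the conjectural stable list; Li–Wang arXiv:2108.03622 symmetry
improvement + Kotschwar 2008 for the near-round-cone regime.
Size: open-problem class.  Sources: arXiv:1008.0842 Thm 1.1, 1.3, Rem 1.6; math/0404165 §2–4;
arXiv:1703.02918; arXiv:1504.01996; ColdingMinicozzi2012; arXiv:2108.03622; card §Transfer C⁺₁,
§Barriers (i); TRIAGE-r1-2 sharpen (1) ("state (D)/stability only for AC data"), TRIAGE-r1-3. -/
theorem stub_stableGap :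
    ∀ (M : Type) [TopologicalSpace M] [T2Space M] [SecondCountableTopology M]
      [ChartedSpace (EuclideanSpace ℝ (Fin 4)) M] [IsManifold (𝓡 4) ∞ M] [ConnectedSpace M]
      [NoncompactSpace M] [T3Space M] [MeasurableSpace M] [BorelSpace M]
      (g : PseudoRiemannianMetric (𝓡 4) ∞ (EuclideanSpace ℝ (Fin 4)) (TangentSpace (𝓡 4) : M → Type _))
      [g.HasLeviCivita] (f : M → ℝ) (hg : g.IsRiemannian),
      (∀ (x : M) (r : NNReal), IsCompact {y : M | g.edist hg x y ≤ r}) →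
      ContMDiff (𝓡 4) 𝓘(ℝ, ℝ) ∞ f →
      (∀ (x : M) (X Y : TangentSpace (𝓡 4) x),
        g.ricci x X Y + g.hessian f x X Y = (1 / 2 : ℝ) * g.val x X Y) →
      (∀ x : M, g.scalarCurvature x + g.gradSq f x = f x) →
      (∃ x : M, g.scalarCurvature x ≠ 0) →
      (∃ C : ℝ, CurvatureBoundedBy g g.leviCivita C) →
      (∀ ε : ℝ, 0 < ε → ∃ K : Set M, IsCompact K ∧ ∀ x : M, x ∉ K → g.scalarCurvature x < ε) →
      (∀ (g' : PseudoRiemannianMetric (𝓡 4) ∞ (EuclideanSpace ℝ (Fin 4)) (TangentSpace (𝓡 4) : M → Type _))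
        [g'.HasLeviCivita] (hg' : g'.IsRiemannian),
        (∃ K : Set M, IsCompact K ∧ ∀ x : M, x ∉ K → g'.val x = g.val x) →
        ∀ c : ℝ,
        (∀ τ : ℝ, 0 < τ → ∀ φ : M → ℝ, ContMDiff (𝓡 4) 𝓘(ℝ, ℝ) ∞ φ →
          ∫ x, (4 * Real.pi * τ) ^ (-(4 : ℝ) / 2) * Real.exp (-φ x) ∂(riemannianMeasure (g'.toContMDiffRiemannianMetric hg')) = 1 →
          c ≤ ∫ x, (τ * (g'.scalarCurvature x + g'.gradSq φ x) + φ x - 4) *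
            ((4 * Real.pi * τ) ^ (-(4 : ℝ) / 2) * Real.exp (-φ x)) ∂(riemannianMeasure (g'.toContMDiffRiemannianMetric hg'))) →
        ENNReal.ofReal (16 * Real.pi ^ 2 * Real.exp c) ≤
          ∫⁻ x, ENNReal.ofReal (Real.exp (-f x)) ∂(riemannianMeasure (g.toContMDiffRiemannianMetric hg))) →
      ∫⁻ x, ENNReal.ofReal (Real.exp (-f x)) ∂(riemannianMeasure (g.toContMDiffRiemannianMetric hg)) ≤
        ENNReal.ofReal (32 * Real.pi ^ 2 * Real.sqrt Real.pi * Real.exp (-(3 : ℝ) / 2)) := by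
  sorry

/-- **stub 5 — `stub_immortalGap` (C⁺₂: UPWARD-IMMORTAL AC SHRINKERS ARE SUB-CYLINDRICAL — the
Ricci side of Bernstein–Wang's immortal branch).** A member `(M,g,f)` of the crux class with bounded
curvature and `R → 0` at infinity which ADMITS a ν-raising compactly supported perturbation (some `g'`
with `g' = g` off a compact set, `NuFloor(g',c)` and `Z(g,f) < 16π² e^c`) and ALL of whose ν-raising
compactly supported perturbations are immortal (`Immortal(g')`: a Ricci flow of Riemannian metrics on
`[0,∞)` from `g'` with curvature bounded on compact time intervals) satisfies `Z(g,f) ≤ Z₀`.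
Mechanism (card §Transfer C⁺₂, the "star-shaped theorem" transplanted): the exact shrinker flow
`(1−t)φ_t^*g` collapses the core onto its asymptotic cone `C` at `t = 1`; a perturbation with
`ν(g') > log Θ(g)` cannot form that (or any `Θ ≤ Θ(g)`) singularity, and by hypothesis forms none at
all, while far out it stays asymptotic to `C` for all time (pseudolocality; the cone at infinity is
preserved); so the immortal flow passes smoothly through `t = 1` and its forward blow-down should be an
asymptotically conical EXPANDER on the same `M` with the same cone (Type-III analysis; existence/degree
theory of expanders out of cones: Deruelle 2016, Bamler–Chen arXiv:2305.03154; flows out of conical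
singularities: Gianniotis–Schulze 2018; relative entropy for expanders: Deruelle–Schulze) — `M` then carries a shrinker and an expander asymptotic to ONE cone
joined by a smooth flow that never saw the conical singularity ("no bounce").  MCF template, a THEOREM
there: Bernstein–Wang arXiv:1504.01996 Thm 1.1, Cor 1.2 — both one-sided flows of a non-flat AC
self-shrinker of small entropy are immortal, star-shaped, and this plus topology and Brendle's genus-0
classification gives `λ ≥ λ(S¹×ℝ)` in `ℝ³`; the Ricci dictionary `λ ↦ 1/Θ`, Huisken ↦ Perelman ν,
one-sided push ↦ ν-raising `Pert`, star-shaped expander ↦ AC expander (card §Why it bites here).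
Why it might fail: the Ricci-side endgame is unformulated beyond this sketch — "no bounce" (a manifold
carrying an AC shrinker and an AC expander with the same cone, joined as above, is flat) and the residual
"RF-Brendle" (shrinkers on `ℝ⁴` with an `S³`-coned end and `Θ > .791` are flat; tools: Li–Wang
arXiv:2108.03622, Kotschwar 2008, Kotschwar–Wang arXiv:1901.00044 Thm 1–2) are conjectures; FIK shows the
expander out of the FIK cone lives on `ℂ²`, not on `Bl₀ℂ²`, consistent but untested as a mechanism.  An
upward-immortal AC shrinker with `Θ ∈ (.791,1)` refutes the stub AND the crux.
Size: open-problem class.  Sources: arXiv:1504.01996; arXiv:1803.00637 §2 (Hershkovits–White one-sided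
push); arXiv:2305.03154; Deruelle2016; arXiv:1901.00044; arXiv:2108.03622; math/0404165 §4; card
§Transfer C⁺₂, §Cheapest falsifier (2) ("an immortal flow on Bl₀ℂ² out of a destabilised FIK would be the
first Ricci instance of the Bernstein–Wang phenomenon"). -/
theorem stub_immortalGap :
    ∀ (M : Type) [TopologicalSpace M] [T2Space M] [SecondCountableTopology M]
      [ChartedSpace (EuclideanSpace ℝ (Fin 4)) M] [IsManifold (𝓡 4) ∞ M] [ConnectedSpace M]
      [NoncompactSpace M] [T3Space M] [MeasurableSpace M] [BorelSpace M]
      (g : PseudoRiemannianMetric (𝓡 4) ∞ (EuclideanSpace ℝ (Fin 4)) (TangentSpace (𝓡 4) : M → Type _))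
      [g.HasLeviCivita] (f : M → ℝ) (hg : g.IsRiemannian),
      (∀ (x : M) (r : NNReal), IsCompact {y : M | g.edist hg x y ≤ r}) →
      ContMDiff (𝓡 4) 𝓘(ℝ, ℝ) ∞ f →
      (∀ (x : M) (X Y : TangentSpace (𝓡 4) x),
        g.ricci x X Y + g.hessian f x X Y = (1 / 2 : ℝ) * g.val x X Y) →
      (∀ x : M, g.scalarCurvature x + g.gradSq f x = f x) →
      (∃ x : M, g.scalarCurvature x ≠ 0) →
      (∃ C : ℝ, CurvatureBoundedBy g g.leviCivita C) →
      (∀ ε : ℝ, 0 < ε → ∃ K : Set M, IsCompact K ∧ ∀ x : M, x ∉ K → g.scalarCurvature x < ε) →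
      (∃ (g' : PseudoRiemannianMetric (𝓡 4) ∞ (EuclideanSpace ℝ (Fin 4)) (TangentSpace (𝓡 4) : M → Type _))
        (_ : g'.HasLeviCivita) (hg' : g'.IsRiemannian),
        (∃ K : Set M, IsCompact K ∧ ∀ x : M, x ∉ K → g'.val x = g.val x) ∧
        ∃ c : ℝ,
        (∀ τ : ℝ, 0 < τ → ∀ φ : M → ℝ, ContMDiff (𝓡 4) 𝓘(ℝ, ℝ) ∞ φ →
          ∫ x, (4 * Real.pi * τ) ^ (-(4 : ℝ) / 2) * Real.exp (-φ x) ∂(riemannianMeasure (g'.toContMDiffRiemannianMetric hg')) = 1 →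
          c ≤ ∫ x, (τ * (g'.scalarCurvature x + g'.gradSq φ x) + φ x - 4) *
            ((4 * Real.pi * τ) ^ (-(4 : ℝ) / 2) * Real.exp (-φ x)) ∂(riemannianMeasure (g'.toContMDiffRiemannianMetric hg'))) ∧
        ∫⁻ x, ENNReal.ofReal (Real.exp (-f x)) ∂(riemannianMeasure (g.toContMDiffRiemannianMetric hg)) <
          ENNReal.ofReal (16 * Real.pi ^ 2 * Real.exp c)) →
      (∀ (g' : PseudoRiemannianMetric (𝓡 4) ∞ (EuclideanSpace ℝ (Fin 4)) (TangentSpace (𝓡 4) : M → Type _))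
        [g'.HasLeviCivita] (hg' : g'.IsRiemannian),
        (∃ K : Set M, IsCompact K ∧ ∀ x : M, x ∉ K → g'.val x = g.val x) →
        ∀ c : ℝ,
        (∀ τ : ℝ, 0 < τ → ∀ φ : M → ℝ, ContMDiff (𝓡 4) 𝓘(ℝ, ℝ) ∞ φ →
          ∫ x, (4 * Real.pi * τ) ^ (-(4 : ℝ) / 2) * Real.exp (-φ x) ∂(riemannianMeasure (g'.toContMDiffRiemannianMetric hg')) = 1 →
          c ≤ ∫ x, (τ * (g'.scalarCurvature x + g'.gradSq φ x) + φ x - 4) *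
            ((4 * Real.pi * τ) ^ (-(4 : ℝ) / 2) * Real.exp (-φ x)) ∂(riemannianMeasure (g'.toContMDiffRiemannianMetric hg'))) →
        ∫⁻ x, ENNReal.ofReal (Real.exp (-f x)) ∂(riemannianMeasure (g.toContMDiffRiemannianMetric hg)) <
          ENNReal.ofReal (16 * Real.pi ^ 2 * Real.exp c) →
        (∃ (G : ℝ → PseudoRiemannianMetric (𝓡 4) ∞ (EuclideanSpace ℝ (Fin 4)) (TangentSpace (𝓡 4) : M → Type _))
          (cov : ℝ → CovariantDerivative (𝓡 4) (EuclideanSpace ℝ (Fin 4)) (TangentSpace (𝓡 4) : M → Type _)),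
          IsRicciFlow G cov (Set.Ici 0) ∧ G 0 = g' ∧ (∀ t ∈ Set.Ici (0 : ℝ), (G t).IsRiemannian) ∧
          ∀ T : ℝ, ∃ C : ℝ, ∀ t ∈ Set.Icc 0 T, CurvatureBoundedBy (G t) (cov t) C)) →
      ∫⁻ x, ENNReal.ofReal (Real.exp (-f x)) ∂(riemannianMeasure (g.toContMDiffRiemannianMetric hg)) ≤
        ENNReal.ofReal (32 * Real.pi ^ 2 * Real.sqrt Real.pi * Real.exp (-(3 : ℝ) / 2)) := by
  sorry

/-- Threshold arithmetic for the composition: `Z₀ = 16π²·e^{ν_cyl}`, so `Z₀ < 16π² e^c` forces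
`ν_cyl < c` (`ν_cyl = log 2 + ½ log π − 3/2`). [folklore] -/
theorem nucyl_lt_of_lt (c : ℝ)
    (h : ENNReal.ofReal (32 * Real.pi ^ 2 * Real.sqrt Real.pi * Real.exp (-(3 : ℝ) / 2)) <
      ENNReal.ofReal (16 * Real.pi ^ 2 * Real.exp c)) :
    Real.log 2 + Real.log Real.pi / 2 - 3 / 2 < c := by
  have hπ : 0 < Real.pi := Real.pi_pos
  have h16 : 0 < 16 * Real.pi ^ 2 := by positivity
  have h1 : 32 * Real.pi ^ 2 * Real.sqrt Real.pi * Real.exp (-(3 : ℝ) / 2) < 16 * Real.pi ^ 2 * Real.exp c :=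
    (ENNReal.ofReal_lt_ofReal_iff (by positivity)).mp h
  have hkey : Real.exp (Real.log 2 + Real.log Real.pi / 2 - 3 / 2) =
      2 * Real.sqrt Real.pi * Real.exp (-(3 : ℝ) / 2) := by
    rw [show Real.log 2 + Real.log Real.pi / 2 - 3 / 2 =
        Real.log 2 + Real.log Real.pi / 2 + (-(3 : ℝ) / 2) by ring, Real.exp_add, Real.exp_add,
      Real.exp_log (by norm_num : (0 : ℝ) < 2), Real.sqrt_eq_rpow, Real.rpow_def_of_pos hπ]
    ring_nf
  have h2 : 16 * Real.pi ^ 2 * Real.exp (Real.log 2 + Real.log Real.pi / 2 - 3 / 2) <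
      16 * Real.pi ^ 2 * Real.exp c := by
    rw [hkey]; nlinarith [h1]
  exact Real.exp_lt_exp.mp (lt_of_mul_lt_mul_left h2 h16.le)

/-- **The composition (kernel-checked; no `sorry` of its own): the five stubs imply the crux BY NAME.**
Given the crux data `(M,g,f)` and, absurdly, `Z₀ < Z(g,f)`: stub 1 gives the densest member
`(Ms,gs,fs)`, so `Z₀ < Z(g,f) ≤ Z(gs,fs)`; stub 2 gives `BddCurv(gs) ∧ ScalarFlat(gs)`; for every
ν-raising perturbation `g'` of `gs` (floor `c`, `Z(gs,fs) < 16π²e^c`, hence `ν_cyl < c` by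
`nucyl_lt_of_lt`) stub 3 yields `Immortal(g')` or a member with `Z ≥ 16π²e^c > Z(gs,fs)` — the latter
contradicts maximality — so `(Ms,gs,fs)` is upward-immortal; if some perturbation raises ν, stub 5 gives
`Z(gs,fs) ≤ Z₀`, otherwise the stability hypothesis of stub 4 holds and stub 4 gives the same;
either way `Z₀ < Z(gs,fs) ≤ Z₀`, absurd. -/
theorem NoncompactShrinkerGap_of : NoncompactShrinkerGap := by
  intro M _ _ _ _ _ _ _ _ _ _ g _ f hg hc hf hsol hnorm hnf
  by_contra hlt
  rw [not_le] at hlt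
  -- (E) the densest complete non-compact non-flat shrinker `(Ms, gs, fs)` exists (stub 1) and is at least as dense as `(M, g, f)`
  obtain ⟨Ms, _, _, _, _, _, _, _, _, _, _, gs, _, fs, hgs, hcs, hfs, hsols, hnorms, hnfs, hmax⟩ := stub_maximiser
  have hZs : ENNReal.ofReal (32 * Real.pi ^ 2 * Real.sqrt Real.pi * Real.exp (-(3 : ℝ) / 2)) <
      ∫⁻ x, ENNReal.ofReal (Real.exp (-fs x)) ∂(riemannianMeasure (gs.toContMDiffRiemannianMetric hgs)) :=
    lt_of_lt_of_le hlt (hmax M g f hg hc hf hsol hnorm hnf)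
  -- (stub 2) a dense shrinker has bounded curvature and is scalar-flat at infinity (asymptotically conical)
  obtain ⟨hbdd, hflat⟩ := stub_denseIsConical Ms gs fs hgs hcs hfs hsols hnorms hnfs hZs
  -- (D) at the maximiser every ν-raising compactly supported perturbation flows immortally (stub 3 + maximality)
  have himm : (∀ (g' : PseudoRiemannianMetric (𝓡 4) ∞ (EuclideanSpace ℝ (Fin 4)) (TangentSpace (𝓡 4) : Ms → Type _))
        [g'.HasLeviCivita] (hg' : g'.IsRiemannian),
        (∃ K : Set Ms, IsCompact K ∧ ∀ x : Ms, x ∉ K → g'.val x = gs.val x) →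
        ∀ c : ℝ,
        (∀ τ : ℝ, 0 < τ → ∀ φ : Ms → ℝ, ContMDiff (𝓡 4) 𝓘(ℝ, ℝ) ∞ φ →
          ∫ x, (4 * Real.pi * τ) ^ (-(4 : ℝ) / 2) * Real.exp (-φ x) ∂(riemannianMeasure (g'.toContMDiffRiemannianMetric hg')) = 1 →
          c ≤ ∫ x, (τ * (g'.scalarCurvature x + g'.gradSq φ x) + φ x - 4) *
            ((4 * Real.pi * τ) ^ (-(4 : ℝ) / 2) * Real.exp (-φ x)) ∂(riemannianMeasure (g'.toContMDiffRiemannianMetric hg'))) →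
        ∫⁻ x, ENNReal.ofReal (Real.exp (-fs x)) ∂(riemannianMeasure (gs.toContMDiffRiemannianMetric hgs)) <
          ENNReal.ofReal (16 * Real.pi ^ 2 * Real.exp c) →
        (∃ (G : ℝ → PseudoRiemannianMetric (𝓡 4) ∞ (EuclideanSpace ℝ (Fin 4)) (TangentSpace (𝓡 4) : Ms → Type _))
          (cov : ℝ → CovariantDerivative (𝓡 4) (EuclideanSpace ℝ (Fin 4)) (TangentSpace (𝓡 4) : Ms → Type _)),
          IsRicciFlow G cov (Set.Ici 0) ∧ G 0 = g' ∧ (∀ t ∈ Set.Ici (0 : ℝ), (G t).IsRiemannian) ∧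
          ∀ T : ℝ, ∃ C : ℝ, ∀ t ∈ Set.Icc 0 T, CurvatureBoundedBy (G t) (cov t) C)) := by
    intro g' _ hg' hpert c hfloor hraise
    have hc : Real.log 2 + Real.log Real.pi / 2 - 3 / 2 < c := nucyl_lt_of_lt c (hZs.trans hraise)
    rcases stub_decayOrExpand Ms gs hgs hcs hbdd g' hg' hpert c hc hfloor with himm |
      ⟨M', _, _, _, _, _, _, _, _, _, _, g'', _, f'', hg'', hc'', hf'', hsol'', hnorm'', hnf'', hZ''⟩
    · exact himm
    · exact absurd (hZ''.trans (hmax M' g'' f'' hg'' hc'' hf'' hsol'' hnorm'' hnf'')) (not_le.mpr hraise)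
  -- (C⁺) decay-or-expand dichotomy at the maximiser: stub 5 if some perturbation raises ν, stub 4 otherwise
  by_cases hex : (∃ (g' : PseudoRiemannianMetric (𝓡 4) ∞ (EuclideanSpace ℝ (Fin 4)) (TangentSpace (𝓡 4) : Ms → Type _))
        (_ : g'.HasLeviCivita) (hg' : g'.IsRiemannian),
        (∃ K : Set Ms, IsCompact K ∧ ∀ x : Ms, x ∉ K → g'.val x = gs.val x) ∧
        ∃ c : ℝ,
        (∀ τ : ℝ, 0 < τ → ∀ φ : Ms → ℝ, ContMDiff (𝓡 4) 𝓘(ℝ, ℝ) ∞ φ →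
          ∫ x, (4 * Real.pi * τ) ^ (-(4 : ℝ) / 2) * Real.exp (-φ x) ∂(riemannianMeasure (g'.toContMDiffRiemannianMetric hg')) = 1 →
          c ≤ ∫ x, (τ * (g'.scalarCurvature x + g'.gradSq φ x) + φ x - 4) *
            ((4 * Real.pi * τ) ^ (-(4 : ℝ) / 2) * Real.exp (-φ x)) ∂(riemannianMeasure (g'.toContMDiffRiemannianMetric hg'))) ∧
        ∫⁻ x, ENNReal.ofReal (Real.exp (-fs x)) ∂(riemannianMeasure (gs.toContMDiffRiemannianMetric hgs)) <
          ENNReal.ofReal (16 * Real.pi ^ 2 * Real.exp c))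
  · exact absurd (stub_immortalGap Ms gs fs hgs hcs hfs hsols hnorms hnfs hbdd hflat hex himm) (not_le.mpr hZs)
  · have hstable : (∀ (g' : PseudoRiemannianMetric (𝓡 4) ∞ (EuclideanSpace ℝ (Fin 4)) (TangentSpace (𝓡 4) : Ms → Type _))
        [g'.HasLeviCivita] (hg' : g'.IsRiemannian),
        (∃ K : Set Ms, IsCompact K ∧ ∀ x : Ms, x ∉ K → g'.val x = gs.val x) →
        ∀ c : ℝ,
        (∀ τ : ℝ, 0 < τ → ∀ φ : Ms → ℝ, ContMDiff (𝓡 4) 𝓘(ℝ, ℝ) ∞ φ →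
          ∫ x, (4 * Real.pi * τ) ^ (-(4 : ℝ) / 2) * Real.exp (-φ x) ∂(riemannianMeasure (g'.toContMDiffRiemannianMetric hg')) = 1 →
          c ≤ ∫ x, (τ * (g'.scalarCurvature x + g'.gradSq φ x) + φ x - 4) *
            ((4 * Real.pi * τ) ^ (-(4 : ℝ) / 2) * Real.exp (-φ x)) ∂(riemannianMeasure (g'.toContMDiffRiemannianMetric hg'))) →
        ENNReal.ofReal (16 * Real.pi ^ 2 * Real.exp c) ≤
          ∫⁻ x, ENNReal.ofReal (Real.exp (-fs x)) ∂(riemannianMeasure (gs.toContMDiffRiemannianMetric hgs))) := by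
      intro g' i' hg' hpert c hfloor
      by_contra h
      exact hex ⟨g', i', hg', hpert, c, hfloor, not_le.mp h⟩
    exact absurd (stub_stableGap Ms gs fs hgs hcs hfs hsols hnorms hnfs hbdd hflat hstable) (not_le.mpr hZs)

end Summit.SmoothPoincare4.SmoothPoincare4.Cruxes.NoncompactShrinkerGap.DecayOrExpand

end
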